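import Mathlib.LinearAlgebra.Matrix.MvPolynomial
import Mathlib.LinearAlgebra.Matrix.Permanent
import Mathlib.LinearAlgebra.Matrix.Determinant.Basic
import Mathlib.LinearAlgebra.Matrix.Trace
import Mathlib.GroupTheory.Perm.Cycle.Type
import Mathlib.RingTheory.MvPolynomial.Homogeneous
import Mathlib.Algebra.CharP.Defs
import Literature.Computability.AlgebraicComplexity.ArithCircuit
import Literature.Computability.AlgebraicComplexity.ValiantClasses
import HarnessLib

-- provenance: harness21/H21/H21/Prelude/CplxAlg/StandardFamilies.lean @ 92cfc90 (interim HEAD d8f2665); M5 mechanical rewrite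
/-!
# Standard polynomial families: permanent, determinant, Hamiltonian cycle, iterated matrix product

Trunk `CplxAlg` (algebraic complexity, Valiant's classes), glue for the notion
`valiant_classes_VP_VNP`. We define the benchmark polynomials of algebraic complexity theory as
multivariate polynomials in the entries of Mathlib's generic matrix `Matrix.mvPolynomialX`:

* `perPoly n k = per (X_{ij})`, the generic permanent (Valiant 1979; Bürgisser 2000, (2.2));
* `detPoly n k = det (X_{ij})`, the generic determinant (Bürgisser 2000, (2.1));
* `hcPoly n k = HC (X_{ij}) = ∑_{π an n-cycle} ∏ᵢ X_{π i, i}`, the Hamiltonian cycle polynomial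
  (Bürgisser 2000, (2.3); Valiant 1979), via the auxiliary `Matrix.hamiltonianCycleSum`;
* `immMatrix n d k = X^{(1)} X^{(2)} ⋯ X^{(d)}`, the ordered product of `d` generic `n × n`
  matrices in disjoint variables, and `immPoly n d k = tr (X^{(1)} ⋯ X^{(d)})`, the iterated
  matrix multiplication polynomial `IMM_{n,d}` (Limaye–Srinivasan–Tavenas 2021, §2);
* the bundled families `perFamily`, `detFamily`, `hcFamily : PolyFamily k` indexed by `Fin n`.

## Sources
* L. G. Valiant, *Completeness classes in algebra*, STOC 1979.
* P. Bürgisser, *Completeness and Reduction in Algebraic Complexity Theory*, Springer 2000, Ch. 2.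
* N. Limaye, S. Srinivasan, S. Tavenas, *Superpolynomial lower bounds against low-depth
  algebraic circuits*, FOCS 2021, §2.

## Design choices
* Argument order `(n) (k)` as in `Matrix.mvPolynomialX n n k`; the index type `n` is any
  `[Fintype n] [DecidableEq n]`, families are then taken over `Fin n`.
* `perPoly (Fin m) k` is *definitionally* `Literature.PNP.per k m` (the `rfl` bridge is stated in the
  statement file `PermanentVsDeterminant`).
* `Matrix.hamiltonianCycleSum` is a deliberate dot-notation extension of Mathlib's `Matrix`
  namespace (Mathlib has `Matrix.permanent`, `Matrix.det`, but no Hamiltonian cycle sum; searched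
  `hamiltonian` — only `SimpleGraph.IsHamiltonian` exists, for graphs). For `card n ≤ 1` no
  permutation has cycle type `{card n}` (cycle types contain only entries `≥ 2`), so the sum is `0`;
  this edge convention is harmless for the asymptotic statements.
* `immPoly` uses the trace of the iterated product rather than the `(1,1)` entry used by
  LST 2021, §2: the two differ by a restriction / a sum of `n` copies and this changes only
  constants in the lower bounds (statement `S29`); the trace needs no `NeZero n` hypothesis.
* Mathlib reused: `Matrix.mvPolynomialX`, `Matrix.permanent`, `Matrix.det`, `Matrix.trace`,
  `Equiv.Perm.cycleType`, `MvPolynomial.IsHomogeneous`, `Matrix.eval_det_mvPolynomialX`.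
  Mathlib has no homogeneity / total degree lemmas for `det (mvPolynomialX ..)`; homogeneity is
  proved here, the total degree and p-family lemmas are stated with `sorry` proofs.

Everything lives in `namespace Literature.CplxAlg` (except `Matrix.hamiltonianCycleSum`), inside a
`noncomputable section`.
-/

noncomputable section

open MvPolynomial Finset

namespace Matrix

variable {n : Type*} [Fintype n] [DecidableEq n] {R : Type*} [CommSemiring R]

/-- The *Hamiltonian cycle sum* of a square matrix `M`:
`HC(M) = ∑_{π} ∏ᵢ M (π i) i`, the sum ranging over the permutations `π` of `n` consisting of a
single cycle of full length `card n` (Bürgisser 2000, (2.3); Valiant 1979). This is a deliberate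
dot-notation extension of Mathlib's `Matrix` namespace, analogous to `Matrix.permanent`.
Edge convention: for `card n ≤ 1` no permutation has cycle type `{card n}`, so the sum is `0`. [cite: Burgisser2000, (2.3] -/
def hamiltonianCycleSum (M : Matrix n n R) : R :=
  ∑ π ∈ univ.filter (fun π : Equiv.Perm n => π.cycleType = {Fintype.card n}), ∏ i, M (π i) i

end Matrix

namespace Literature.Computability.AlgebraicComplexity

universe u

section Defs

variable (n : Type*) [Fintype n] [DecidableEq n] (k : Type u)

/-- The generic permanent `PER_n = per (X_{ij}) = ∑_{π ∈ 𝔖ₙ} ∏ᵢ X_{π i, i}` in the `n²` variables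
`X_{ij}`, as the permanent of `Matrix.mvPolynomialX n n k` (Valiant 1979; Bürgisser 2000, (2.2)).
`perPoly (Fin m) k = Literature.PNP.per k m` holds by `rfl`. [cite: Valiant1979] -/
def perPoly [CommSemiring k] : MvPolynomial (n × n) k :=
  (Matrix.mvPolynomialX n n k).permanent

/-- The generic determinant `DET_n = det (X_{ij})` in the `n²` variables `X_{ij}`, as the
determinant of `Matrix.mvPolynomialX n n k` (Bürgisser 2000, (2.1); Valiant 1979). [cite: Burgisser2000, (2.1] -/
def detPoly [CommRing k] : MvPolynomial (n × n) k :=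
  (Matrix.mvPolynomialX n n k).det

/-- The generic Hamiltonian cycle polynomial `HC_n = ∑_{π an n-cycle} ∏ᵢ X_{π i, i}` in the `n²`
variables `X_{ij}` (Bürgisser 2000, (2.3); Valiant 1979). It is `0` when `card n ≤ 1`
(see `Matrix.hamiltonianCycleSum`). [cite: Burgisser2000, (2.3] -/
def hcPoly [CommSemiring k] : MvPolynomial (n × n) k :=
  (Matrix.mvPolynomialX n n k).hamiltonianCycleSum

end Defs

/-- The ordered product `X^{(0)} X^{(1)} ⋯ X^{(d-1)}` of `d` generic `n × n` matrices in pairwise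
disjoint sets of variables `X^{(t)}_{ij}`, `t : Fin d` (Limaye–Srinivasan–Tavenas 2021, §2).
For `d = 0` this is the identity matrix. [cite: LimayeSrinivasanTavenas2021, §2] -/
def immMatrix (n : Type*) [Fintype n] [DecidableEq n] (d : ℕ) (k : Type u) [CommSemiring k] :
    Matrix n n (MvPolynomial (Fin d × n × n) k) :=
  ((List.finRange d).map fun t =>
    (Matrix.mvPolynomialX n n k).map (rename fun ij : n × n => (t, ij))).prod

/-- The iterated matrix multiplication polynomial `IMM_{n,d} = tr (X^{(0)} ⋯ X^{(d-1)})` in the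
`d n²` variables `X^{(t)}_{ij}` (Limaye–Srinivasan–Tavenas 2021, §2, who use the `(1,1)` entry
instead of the trace; the two differ only by constants in the lower bounds, and the trace needs
no `NeZero n`). [cite: LimayeSrinivasanTavenas2021, §2  who use the  (1 1] -/
def immPoly (n d : ℕ) (k : Type u) [CommSemiring k] : MvPolynomial (Fin d × Fin n × Fin n) k :=
  (immMatrix (Fin n) d k).trace

section API

variable {n : Type*} [Fintype n] [DecidableEq n] {k : Type u}

/-- Evaluating the generic permanent at a point `s` gives the permanent of the matrix
`(s (i, j))ᵢⱼ` (cf. `Matrix.eval_det_mvPolynomialX`; Bürgisser 2000, (2.2)). [cite: Burgisser2000, (2.2] -/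
theorem eval_perPoly [CommSemiring k] (s : n × n → k) :
    eval s (perPoly n k) = (Matrix.of fun i j : n => s (i, j)).permanent := by
  simp [perPoly, Matrix.permanent, map_sum, map_prod, Matrix.mvPolynomialX]

/-- Evaluating the generic determinant at a point `s` gives the determinant of the matrix
`(s (i, j))ᵢⱼ` (`Matrix.eval_det_mvPolynomialX`; Bürgisser 2000, (2.1)). [cite: Burgisser2000, (2.1] -/
theorem eval_detPoly [CommRing k] (s : n × n → k) :
    eval s (detPoly n k) = (Matrix.of fun i j : n => s (i, j)).det :=
  Matrix.eval_det_mvPolynomialX n k s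

/-- Evaluating the generic Hamiltonian cycle polynomial at a point `s` gives the Hamiltonian cycle
sum of the matrix `(s (i, j))ᵢⱼ` (Bürgisser 2000, (2.3)). [cite: Burgisser2000, (2.3] -/
theorem eval_hcPoly [CommSemiring k] (s : n × n → k) :
    eval s (hcPoly n k) = (Matrix.of fun i j : n => s (i, j)).hamiltonianCycleSum := by
  simp [hcPoly, Matrix.hamiltonianCycleSum, map_sum, map_prod, Matrix.mvPolynomialX]

/-- The generic permanent is homogeneous of degree `card n` (Bürgisser 2000, §2.1). [cite: Burgisser2000, §2.1] -/
theorem perPoly_isHomogeneous [CommSemiring k] :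
    (perPoly n k).IsHomogeneous (Fintype.card n) := by
  unfold perPoly Matrix.permanent
  refine IsHomogeneous.sum _ _ _ fun π _ => ?_
  have := IsHomogeneous.prod (φ := fun i : n => Matrix.mvPolynomialX n n k (π i) i) univ
    (fun _ => 1) fun i _ => by simpa [Matrix.mvPolynomialX] using isHomogeneous_X k (π i, i)
  simpa using this

/-- The generic determinant is homogeneous of degree `card n` (Bürgisser 2000, §2.1). [cite: Burgisser2000, §2.1] -/
theorem detPoly_isHomogeneous [CommRing k] :
    (detPoly n k).IsHomogeneous (Fintype.card n) := by
  rw [detPoly, Matrix.det_apply]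
  refine IsHomogeneous.sum _ _ _ fun π _ => ?_
  have := IsHomogeneous.prod (φ := fun i : n => Matrix.mvPolynomialX n n k (π i) i) univ
    (fun _ => 1) fun i _ => by simpa [Matrix.mvPolynomialX] using isHomogeneous_X k (π i, i)
  rw [Units.smul_def, zsmul_eq_mul, ← map_intCast (C : k →+* MvPolynomial (n × n) k)]
  simp only [sum_const, smul_eq_mul, mul_one, card_univ] at this
  simpa only [zero_add] using (isHomogeneous_C _ _).mul this

/-- The generic Hamiltonian cycle polynomial is homogeneous of degree `card n`
(Bürgisser 2000, §2.1). [cite: Burgisser2000, §2.1] -/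
theorem hcPoly_isHomogeneous [CommSemiring k] :
    (hcPoly n k).IsHomogeneous (Fintype.card n) := by
  unfold hcPoly Matrix.hamiltonianCycleSum
  refine IsHomogeneous.sum _ _ _ fun π _ => ?_
  have := IsHomogeneous.prod (φ := fun i : n => Matrix.mvPolynomialX n n k (π i) i) univ
    (fun _ => 1) fun i _ => by simpa [Matrix.mvPolynomialX] using isHomogeneous_X k (π i, i)
  simpa using this

/-- The iterated matrix multiplication polynomial `IMM_{n,d}` is homogeneous of degree `d`
(Limaye–Srinivasan–Tavenas 2021, §2). [cite: LimayeSrinivasanTavenas2021, §2] -/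
def immPoly_isHomogeneous : Prop :=
  ∀ [CommSemiring k] (m d : ℕ),
    (immPoly m d k).IsHomogeneous d

/-- Over a nontrivial ring the generic permanent has total degree `card n`
(Bürgisser 2000, §2.1). Over the zero ring the total degree is `0`. [cite: Burgisser2000, §2.1] -/
def totalDegree_perPoly : Prop :=
  ∀ [CommSemiring k] [Nontrivial k],
    (perPoly n k).totalDegree = Fintype.card n

/-- Over a nontrivial ring the generic determinant has total degree `card n`
(Bürgisser 2000, §2.1). Over the zero ring the total degree is `0`. [cite: Burgisser2000, §2.1] -/
def totalDegree_detPoly : Prop :=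
  ∀ [CommRing k] [Nontrivial k],
    (detPoly n k).totalDegree = Fintype.card n

/-- The permanent family `(PER_n)_n` over `Fin n` is a p-family: `n²` variables, degree `n`
(Bürgisser 2000, §2.1). [cite: Burgisser2000, §2.1] -/
def isPFamily_perPoly : Prop :=
  ∀ [CommSemiring k],
    IsPFamily fun m => perPoly (Fin m) k

/-- The determinant family `(DET_n)_n` over `Fin n` is a p-family: `n²` variables, degree `n`
(Bürgisser 2000, §2.1). [cite: Burgisser2000, §2.1] -/
def isPFamily_detPoly : Prop :=
  ∀ [CommRing k],
    IsPFamily fun m => detPoly (Fin m) k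

/-- The Hamiltonian cycle family `(HC_n)_n` over `Fin n` is a p-family: `n²` variables,
degree `≤ n` (Bürgisser 2000, §2.1). [cite: Burgisser2000, §2.1] -/
def isPFamily_hcPoly : Prop :=
  ∀ [CommSemiring k],
    IsPFamily fun m => hcPoly (Fin m) k

/-- Base change: the generic permanent over `k` maps to the generic permanent over `k'` under any
ring homomorphism `f : k →+* k'` (Bürgisser 2000, §2.1). [cite: Burgisser2000, §2.1] -/
theorem map_perPoly [CommSemiring k] {k' : Type*} [CommSemiring k'] (f : k →+* k') :
    map f (perPoly n k) = perPoly n k' := by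
  simp [perPoly, Matrix.permanent, map_sum, map_prod, Matrix.mvPolynomialX]

/-- Base change: the generic determinant over `k` maps to the generic determinant over `k'` under
any ring homomorphism `f : k →+* k'` (Bürgisser 2000, §2.1). [cite: Burgisser2000, §2.1] -/
theorem map_detPoly [CommRing k] {k' : Type*} [CommRing k'] (f : k →+* k') :
    map f (detPoly n k) = detPoly n k' := by
  rw [detPoly, detPoly, (MvPolynomial.map f).map_det]
  congr 1
  ext i j
  simp [Matrix.mvPolynomialX]

/-- Sanity check: in characteristic `2` the generic permanent and determinant coincide, since all
signs are `1` (Bürgisser 2000, §2.1). [cite: Burgisser2000, §2.1] -/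
theorem perPoly_eq_detPoly_of_charP_two [CommRing k] [CharP k 2] :
    perPoly n k = detPoly n k := by
  rw [perPoly, Matrix.permanent, detPoly, Matrix.det_apply]
  refine sum_congr rfl fun π _ => ?_
  rcases Int.units_eq_one_or (Equiv.Perm.sign π) with h | h
  · simp [h]
  · rw [h, Units.neg_smul, one_smul, CharTwo.neg_eq]

end API

section Families

variable (k : Type u)

/-- The permanent family `(PER_n)_n` as a bundled `PolyFamily` (Bürgisser 2000, §2.1). [cite: Burgisser2000, §2.1] -/
def perFamily [CommSemiring k] : PolyFamily k :=
  PolyFamily.ofFintype fun n => perPoly (Fin n) k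

/-- The determinant family `(DET_n)_n` as a bundled `PolyFamily` (Bürgisser 2000, §2.1). [cite: Burgisser2000, §2.1] -/
def detFamily [CommRing k] : PolyFamily k :=
  PolyFamily.ofFintype fun n => detPoly (Fin n) k

/-- The Hamiltonian cycle family `(HC_n)_n` as a bundled `PolyFamily` (Bürgisser 2000, §2.1). [cite: Burgisser2000, §2.1] -/
def hcFamily [CommSemiring k] : PolyFamily k :=
  PolyFamily.ofFintype fun n => hcPoly (Fin n) k

end Families

end Literature.Computability.AlgebraicComplexity

/-! ### Discharge: `IMM_{m,d}` is homogeneous of degree `d` (appended; D-0014 append protocol) -/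

namespace Literature.Computability.AlgebraicComplexity

universe u'

/-- Every entry of the ordered product of the generic matrices along a list `l` of layers
(`X^{(t)}` for `t ∈ l`, each entry a variable, homogeneous of degree `1`) is homogeneous of degree
`l.length` (the identity matrix for `l = []`). [folklore] -/
theorem isHomogeneous_immMatrix_list_prod {k : Type u'} [CommSemiring k] {n : Type*} [Fintype n]
    [DecidableEq n] (d : ℕ) (l : List (Fin d)) (i j : n) :
    (((l.map fun t => (Matrix.mvPolynomialX n n k).map
        (rename fun ij : n × n => (t, ij))).prod) i j).IsHomogeneous l.length := by
  induction l generalizing i j with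
  | nil =>
    simp only [List.map_nil, List.prod_nil, List.length_nil]
    by_cases h : i = j
    · subst h; simpa using isHomogeneous_one (Fin d × n × n) k
    · simpa [Matrix.one_apply_ne h] using isHomogeneous_zero (Fin d × n × n) k 0
  | cons t l ih =>
    simp only [List.map_cons, List.prod_cons, List.length_cons]
    rw [Matrix.mul_apply]
    refine IsHomogeneous.sum _ _ _ fun x _ => ?_
    have h1 : ((Matrix.mvPolynomialX n n k).map
        (rename fun ij : n × n => (t, ij)) i x).IsHomogeneous 1 := by
      simpa [Matrix.mvPolynomialX, Matrix.map_apply] using isHomogeneous_X k (t, (i, x))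
    simpa [add_comm] using h1.mul (ih x j)

/-- **Discharge** of the named fact `immPoly_isHomogeneous`: the iterated matrix multiplication
polynomial `IMM_{m,d} = tr(X⁽⁰⁾ ⋯ X⁽ᵈ⁻¹⁾)` is homogeneous of degree `d` — each diagonal entry of
the product of `d` generic matrices is (`isHomogeneous_immMatrix_list_prod` with
`l = List.finRange d`), hence so is the trace (Limaye–Srinivasan–Tavenas 2021, §2).
[cite: LimayeSrinivasanTavenas2021, §2] -/
theorem immPoly_isHomogeneous_holds {k : Type u'} : immPoly_isHomogeneous (k := k) := by
  intro _ m d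
  unfold immPoly immMatrix Matrix.trace
  refine IsHomogeneous.sum _ _ _ fun i _ => ?_
  simpa [Matrix.diag] using isHomogeneous_immMatrix_list_prod (k := k) d (List.finRange d) i i

end Literature.Computability.AlgebraicComplexity
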